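import Mathlib
import HarnessLib
import Summits.Langlands.Langlands.Theses.ParityBlindBianchi
import Summits.Langlands.Langlands.Theorems.ParityBlindBianchiQuadraticDescentGL2CentralCharacterDescent
import Summits.Langlands.Langlands.Theorems.ParityBlindBianchiQuadraticDescentGL2TwistedAsaiPoleContStub
import Summits.Langlands.Langlands.Theorems.ParityBlindBianchiQuadraticDescentGL2SignReduction
import Summits.Langlands.Langlands.Theorems.ParityBlindBianchiQuadraticDescentGL2FlickerOfHolomorphy
import Literature.NumberTheory.Automorphic.TwistedAsaiPole
import Literature.NumberTheory.Automorphic.TwistedAsaiContinuationGLTwo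
import Literature.NumberTheory.Automorphic.PartialAsaiLHolomorphy
import Literature.NumberTheory.GaloisRepresentations.HeckeCharacter

/-!
# Line `Sketch` — skeleton v3 for the crux `ParityBlindBianchi.QuadraticDescentGL2` (stmt-Langlands-16811)

Lead prover `prover-line-stmt-Langlands-16811-c1-0` (continuation seat c1), 2026-08-17; v1/v2 by
`prover-line-stmt-Langlands-16811-0`. Composition C of the checked line `Sketch` (card `theta-descent-asai-pole`),
trace-formula-free: Galois-stability ⟹ (central character descends, LANDED p143815) ⟹ (one twisted partial Asai
`L`-function of `P` has a continued simple pole at `s = 1`, LANDED p148714 modulo the twisted Asai continuations)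
⟹ (theta descent, apex).

Changes v2 → v3 (this seat):
* `stub_twistedAsaiPoleCont` LANDED (p148714,
  `Summit.Langlands.Langlands.Theorems.QuadraticDescentGL2.Sketch.stub_twistedAsaiPoleCont`) — imported, no longer a stub.
* The fact-stub `stub_factFlickerContinuation` (= the line's bespoke named fact
  `Flicker1988_twistedAsaiL_continuation_GL2`, ACCEPTED p146950 as a `def`) is RESHAPED: the tree already hangs Mok's
  dichotomy and Grbac–Shahidi-at-one on the ONE canonical Asai-continuation fact
  `GrbacShahidi2015_partialAsaiL_holomorphy` (`L²` currency, untwisted; files `AsaiAtOneOfAsaiHolomorphy`,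
  `AsaiSignContOfAsaiHolomorphy`, `PartialAsaiLHolomorphyOfPos`, all proved), and Flicker's twisted `GL₂` statement
  FOLLOWS from it by tree theorems: (W1) unitary reduction of `(P, χ)` by a norm twist, (HR) the PROVED Hewitt–Ross
  extension `HewittRoss_heckeCharacter_extension_quadratic_holds` of the unitary `χ₁` to a unitary `μ` on `E`
  unramified above the complement of `S`, (W3) the twist `P' = P₁ ⊗ μ` carries the Asai datum `(S, μ(ϖ) • A₁)`,
  (W4) its untwisted local Asai factors are the `χ₁`-twisted ones of `A₁` (`TwistedAsaiPole` calculus +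
  `HeckeCharacter.valueAtUniformizer_restrict_of_smul_eq/_ne`), (W5) `P'` is unitary a.e. by the central clause,
  (W6) `CuspidalAutomorphicRepData.hol_of_asaiHolomorphyL2` + `exists_multipliable_asaiEulerFactors` give the
  analytic package for `P'`. So the registered stubs are now the fact `stub_factAsaiHolomorphy` and the five
  tree-grade stubs `stub_unitaryReduction`, `stub_twistAsaiDatum`, `stub_twistedFactors`, `stub_unitaryAE`,
  `stub_holTwisted`, composed here (sorry-free glue `flicker_of_holomorphy`) into
  `Flicker1988_twistedAsaiL_continuation_GL2`.
* `stub_thetaDescentCont` (apex) verbatim as in v2 — true as typed, BC-free in print only via the theta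
  correspondence `(GL₂, GO(X_E))` whose vocabulary is absent from the tree; held by the lead (Lines/Sketch-S3-audit.md).
* v3.1 (wave 1 integrated, same seat): W1, W3, W4, W5, W6 ALL LANDED — p163724
  (`…Theorems.QuadraticDescentGL2.Sketch.stub_unitaryReduction`), p163402 (`…stub_twistAsaiDatum`), p163516
  (`…stub_twistedFactors`), p163525 (`…stub_unitaryAE`), p163478 (`…stub_holTwisted`) — imported and used by name in
  the reduction; they are no longer stubs. The composed reduction `GrbacShahidi2015_partialAsaiL_holomorphy →
  Flicker1988_twistedAsaiL_continuation_GL2` (sorry-free over them, work/stubs/stub_flickerOfHolomorphy.lean) is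
  registered as `stub_flickerOfHolomorphy` so that it lands as a helper of the crux.

`QuadraticDescentGL2_of : QuadraticDescentGL2` composes the landed stubs and the two remaining `stub_*` into the crux
BY NAME. `sorry` occurs ONLY in `stub_factAsaiHolomorphy` (named fact of the tree) and `stub_thetaDescentPos` (apex);
`stub_flickerOfHolomorphy` (W7) LANDED p165573 and is imported.
* v3.2: the apex is cut to the sign `As⁺` (`stub_thetaDescentPos`, exactly the shape of Gan–Takeda's hypothesis); the
  sign `As⁻` is reduced to it by `χ ↦ χ ω_{E/F}` (`stub_signReduction`, class field theory being the tree theorem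
  `exists_isClassFieldCharacter_holds`) through the sorry-free glue `thetaDescentCont_of_pos` (the old
  `stub_thetaDescentCont` statement, now a theorem over the two). v3.3: `stub_signReduction` LANDED p165264 (imported).
-/

set_option linter.dupNamespace false

namespace Summit.Langlands.Langlands.Cruxes.QuadraticDescentGL2.Sketch

open scoped BigOperators Classical
open Filter Set Function Polynomial
open NumberField IsDedekindDomain
open Literature.NumberTheory.Automorphic Literature.NumberTheory.GaloisRepresentations
open Summit.Langlands.Langlands.Theses.ParityBlindBianchi (QuadraticDescentGL2)
open Summit.Langlands.Langlands.Theorems.QuadraticDescentGL2.Sketch (stub_signReduction stub_flickerOfHolomorphy)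

/-! ## §0 plumbing (proved) -/

/-- A Galois quadratic extension has a non-trivial automorphism. [folklore] -/
theorem exists_ne_one_of_finrank_eq_two {F E : Type} [Field F] [Field E] [Algebra F E]
    [IsGalois F E] (h2 : Module.finrank F E = 2) : ∃ c : E ≃ₐ[F] E, c ≠ 1 := by
  by_contra h
  push Not at h
  haveI : FiniteDimensional F E := Module.finite_of_finrank_pos (by omega)
  haveI hsub : Subsingleton (E ≃ₐ[F] E) := ⟨fun a b => by rw [h a, h b]⟩
  have hcard : Nat.card (E ≃ₐ[F] E) = 2 := by
    rw [IsGalois.card_aut_eq_finrank, h2]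
  have h1 : Nat.card (E ≃ₐ[F] E) = 1 := Nat.card_of_subsingleton (1 : E ≃ₐ[F] E)
  omega

/-! ## §1 the fact stub, the apex (`As⁺`) and the sign reduction -/

/-- **Fact-stub (Grbac–Shahidi 2015, Thm. 4.3 (1), (2)(a); in the tree on Flicker's Rankin–Selberg road).** The
canonical Asai-continuation named fact of the tree, `GrbacShahidi2015_partialAsaiL_holomorphy` (`L²` currency, both
signs, every rank): `s (s - 1) L^S(s, Π₀, As^η)` is the restriction of an entire function. Debt shared with
`Mok2014_partialAsaiL_continuation_pole_dichotomy` and `GrbacShahidi2015_partialAsaiL_at_one`.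
[cite: GrbacShahidi2015, Thm. 4.3 (1), (2)(a)] [cite: Flicker1988, Theorem p. 297] -/
theorem stub_factAsaiHolomorphy : GrbacShahidi2015_partialAsaiL_holomorphy := by
  sorry

/-- **Stub 3'' (theta descent from a pole of `L^S(s, P, As⁺ ⊗ χ)`, continuation currency; APEX).** For `E/F`
quadratic with involution `c ≠ 1`, a cuspidal `P` on `GL₂(𝔸_E)` with `ω_P = χ⁻¹ ∘ N_{E/F}` (a.e. on Satake data), and
ONE Asai datum `(S, A) ⊇ ram χ` of `P` at which the twisted partial Asai product `L^S(s, P, As⁺ ⊗ χ)` converges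
beyond some `σ₀ ≥ 1` and `(s - 1) L^S(s, P, As⁺ ⊗ χ)` continues holomorphically to `{1 < Re s} ∪ B(1, δ)` with a
NON-ZERO value at `s = 1` (a simple pole of the continued `L`-function), there is a cuspidal `π` on `GL₂(𝔸_F)` of
which `P` is a weak base-change lift. The sign `As⁻` is reduced to this by `χ ↦ χ ω_{E/F}` (`stub_signReduction`,
`thetaDescentCont_of_pos`). Mechanism (BC-free, TF-free; NOT citable as one printed statement without Langlands' BC):
the theta correspondence for `(GL₂, GO(X_E))`, `GSO(X_E)(𝔸) = (GL₂(𝔸_E) × 𝔸_F^×)/𝔸_E^×`: `(P, χ⁻¹)` is a cuspidal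
`σ₁` on `O(X_E)` with `L^S(s, σ₁) = L^S(s, P, As ⊗ χ)` (Roberts 2001 Lemma 8.1); the pole at `1 = (m - 2r)/2`,
`(m, r) = (4, 1)`, forces `θ₂(σ₁ ⊗ μ) ≠ 0` on `SL₂(𝔸)` (Gan–Takeda 2011 Thm 1.3 (1)), cuspidal by the Rallis tower;
its constituents are cuspidal `Π` on `GL₂(𝔸_F)` (Takeda 2009 §4, Lemmas 4.4–4.5) and the unramified correspondence
gives `BC(Π^∨)_w ≅ P_w` a.e. (Takeda 2009 Props 6.6–6.7). Vocabulary (quadratic space `X_E`, `GO/O(X_E)` adelic and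
automorphy data, Weil representation, theta lifts) absent from the tree: crux-sized (Lines/Sketch-apex-promote.md).
[folklore] -/
theorem stub_thetaDescentPos :
    ∀ (F E : Type) [Field F] [NumberField F] [Field E] [NumberField E] [Algebra F E]
      (c : E ≃ₐ[F] E), Module.finrank F E = 2 → c ≠ 1 →
      ∀ (hF : isCompact_glFiniteIntegralLevel 2 F) (hE : isCompact_glFiniteIntegralLevel 2 E)
        (P : CuspidalAutomorphicRepData 2 E hE) (χ : HeckeCharacter F),
        (∀ᶠ w : HeightOneSpectrum (𝓞 E) in cofinite, ∀ α : Multiset ℂ,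
            P.1.HasSatakeParamAt w α → χ.IsUnramifiedAt (w.under (𝓞 F)) →
              α.prod * χ.valueAtUniformizer (w.under (𝓞 F)) ^ w.asIdeal.inertiaDeg (𝓞 F) = 1) →
        (∃ (S : Set (HeightOneSpectrum (𝓞 F))) (A : SatakeFamily E),
          P.1.IsAsaiDatum c S A ∧ χ.ramifiedPlaces ⊆ S ∧
          ∃ σ₀ : ℝ, 1 ≤ σ₀ ∧
            (∀ s : ℂ, σ₀ < s.re →
              Multipliable fun v : {v : HeightOneSpectrum (𝓞 F) // v ∉ S} =>
                ((asaiLocalPolynomial c A 1 (placeAbove E v.1)).eval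
                  (χ.valueAtUniformizer v.1 * (v.1.residueCard : ℂ) ^ (-s)))⁻¹) ∧
            ∃ (δ : ℝ) (G : ℂ → ℂ), 0 < δ ∧
              DifferentiableOn ℂ G ({s : ℂ | 1 < s.re} ∪ Metric.ball (1 : ℂ) δ) ∧
              (∀ s : ℂ, σ₀ < s.re →
                G s = (s - 1) * partialAsaiLTwist S c A (fun v => χ.valueAtUniformizer v) 1 s) ∧
              G 1 ≠ 0) →
        ∃ π : CuspidalAutomorphicRepData 2 F hF, IsWeakBaseChangeLiftAE π.1 P.1 := by
  sorry

/-- **Both signs from `As⁺` (glue, sorry-free over `stub_thetaDescentPos` + the LANDED `stub_signReduction`, p165264).** The v2/v3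
apex statement `stub_thetaDescentCont` (every sign `η`) follows from its `η = 1` case: for `η = -1` replace `χ` by
the `χ'` of `stub_signReduction`; the twisted `As⁻ ⊗ χ` Euler factors ARE the `As⁺ ⊗ χ'` factors, so multipliability
and the continuation `G` transfer verbatim (`partialAsaiLTwist` is the same `tprod`). [folklore] -/
theorem thetaDescentCont_of_pos :
    ∀ (F E : Type) [Field F] [NumberField F] [Field E] [NumberField E] [Algebra F E]
      (c : E ≃ₐ[F] E), Module.finrank F E = 2 → c ≠ 1 →
      ∀ (hF : isCompact_glFiniteIntegralLevel 2 F) (hE : isCompact_glFiniteIntegralLevel 2 E)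
        (P : CuspidalAutomorphicRepData 2 E hE) (χ : HeckeCharacter F) (η : ℤˣ),
        (∀ᶠ w : HeightOneSpectrum (𝓞 E) in cofinite, ∀ α : Multiset ℂ,
            P.1.HasSatakeParamAt w α → χ.IsUnramifiedAt (w.under (𝓞 F)) →
              α.prod * χ.valueAtUniformizer (w.under (𝓞 F)) ^ w.asIdeal.inertiaDeg (𝓞 F) = 1) →
        (∃ (S : Set (HeightOneSpectrum (𝓞 F))) (A : SatakeFamily E),
          P.1.IsAsaiDatum c S A ∧ χ.ramifiedPlaces ⊆ S ∧
          ∃ σ₀ : ℝ, 1 ≤ σ₀ ∧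
            (∀ s : ℂ, σ₀ < s.re →
              Multipliable fun v : {v : HeightOneSpectrum (𝓞 F) // v ∉ S} =>
                ((asaiLocalPolynomial c A η (placeAbove E v.1)).eval
                  (χ.valueAtUniformizer v.1 * (v.1.residueCard : ℂ) ^ (-s)))⁻¹) ∧
            ∃ (δ : ℝ) (G : ℂ → ℂ), 0 < δ ∧
              DifferentiableOn ℂ G ({s : ℂ | 1 < s.re} ∪ Metric.ball (1 : ℂ) δ) ∧
              (∀ s : ℂ, σ₀ < s.re →
                G s = (s - 1) * partialAsaiLTwist S c A (fun v => χ.valueAtUniformizer v) η s) ∧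
              G 1 ≠ 0) →
        ∃ π : CuspidalAutomorphicRepData 2 F hF, IsWeakBaseChangeLiftAE π.1 P.1 := by
  intro F E _ _ _ _ _ c h2 hc hF hE P χ η hχ ⟨S, A, hSA, hram, σ₀, hσ₀, hmul, δ, G, hδ, hGd, hGeq, hG1⟩
  rcases Int.units_eq_one_or η with rfl | rfl
  · exact stub_thetaDescentPos F E c h2 hc hF hE P χ hχ ⟨S, A, hSA, hram, σ₀, hσ₀, hmul, δ, G, hδ, hGd, hGeq, hG1⟩
  · obtain ⟨χ', hram', hχ', hfac⟩ := stub_signReduction F E c h2 hc hE P χ S A hSA hram hχ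
    refine stub_thetaDescentPos F E c h2 hc hF hE P χ' hχ' ⟨S, A, hSA, hram', σ₀, hσ₀, fun s hs => ?_, δ, G, hδ, hGd,
      fun s hs => ?_, hG1⟩
    · have hm := hmul s hs
      have heq : (fun v : {v : HeightOneSpectrum (𝓞 F) // v ∉ S} =>
          ((asaiLocalPolynomial c A (-1) (placeAbove E v.1)).eval
            (χ.valueAtUniformizer v.1 * (v.1.residueCard : ℂ) ^ (-s)))⁻¹) =
          fun v : {v : HeightOneSpectrum (𝓞 F) // v ∉ S} =>
            ((asaiLocalPolynomial c A 1 (placeAbove E v.1)).eval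
              (χ'.valueAtUniformizer v.1 * (v.1.residueCard : ℂ) ^ (-s)))⁻¹ := by
        funext v
        rw [hfac v.1 v.2]
      rwa [heq] at hm
    · rw [hGeq s hs]
      congr 1
      unfold partialAsaiLTwist
      exact tprod_congr fun v => by rw [hfac v.1 v.2]

/-! ## §2 assembly (sorry-free) -/

/-- **ASSEMBLY — the crux BY NAME from the landed stubs and the two remaining `stub_*` (kernel-checked; the only
`sorry`s in its closure are `stub_factAsaiHolomorphy` (the tree's canonical Asai-continuation named fact) and
`stub_thetaDescentPos` (the theta apex)).** Pick
the involution `c` (`exists_ne_one_of_finrank_eq_two`); `χ` with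
`ω_P = χ⁻¹ ∘ N` on Satake data from the LANDED `Theorems.QuadraticDescentGL2.Sketch.stub_centralCharacterDescent`
(p143815); the sign `η` and an Asai datum carrying a continued simple pole from the LANDED
`Theorems.QuadraticDescentGL2.Sketch.stub_twistedAsaiPoleCont` (p148714) fed with the twisted continuations
`stub_flickerOfHolomorphy stub_factAsaiHolomorphy`; the cuspidal descent from the apex `stub_thetaDescentPos` through `thetaDescentCont_of_pos`.
[folklore] -/
theorem QuadraticDescentGL2_of : QuadraticDescentGL2 := by
  intro F E _ _ _ _ _ _ hfin hF hE P hst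
  obtain ⟨c, hc⟩ := exists_ne_one_of_finrank_eq_two hfin
  obtain ⟨χ, hχ⟩ :=
    Summit.Langlands.Langlands.Theorems.QuadraticDescentGL2.Sketch.stub_centralCharacterDescent
      F E hfin hE P hst
  obtain ⟨η, S, A, hSA, hram, hpole⟩ :=
    Summit.Langlands.Langlands.Theorems.QuadraticDescentGL2.Sketch.stub_twistedAsaiPoleCont
      F E c hfin hc hE P χ hst hχ
      (fun S A hSA hram hcent =>
        stub_flickerOfHolomorphy stub_factAsaiHolomorphy F E c hfin hc hE P χ S A hSA hram hcent)
  exact thetaDescentCont_of_pos F E c hfin hc hF hE P χ η hχ ⟨S, A, hSA, hram, hpole⟩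

end Summit.Langlands.Langlands.Cruxes.QuadraticDescentGL2.Sketch
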